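import Summits.HodgeConjecture.HodgeConjecture.Theorems.HLiu418ScalarSpectralJunction
import Summits.HodgeConjecture.HodgeConjecture.Theorems.H413SpectrumOrthogonality
import Summits.HodgeConjecture.HodgeConjecture.Theorems.F0P3StubS3Fold
import Literature.NumberTheory.Automorphic.UnitaryCurveCohCotangentForms
import HarnessLib

/-!
# Crux `HLiu418`, line `F0_AlbCm` ∕ sub-sub-line `F0_AlbCmS1Betti` — the GENERIC CORE of the line folds: «one line of `A`-valued intertwiners
# from detection, uniqueness and the isotypic line» (shared by (L10) and (L01); n = 2 scalar currency)

Floor-0 programme P5 (Alb-CM), seat F0P5-p03 (g0); crux item stmt-HodgeConjecture-24832 (`HCCMUnconditional.HLiu418`).  Letter-free, `sorry`-free.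
HC_CM is proved only modulo the 7 printed citations until rung 0 closes.

* uses ★ `F0P3StubS3Fold.mem_space_of_forall_detected_eq` — «all projections but THE `P₀` vanish ⇒ the class lies in `P₀`» (F0P3-p03; imported);
* `exists_intertwiningLine_of_letters` — for `U(J)`, `J ∈ M₂(E)`, with COMPACT quotient, discretely decomposable `L²` of multiplicity one, an
  IRREDUCIBLE `σ`, and a Hodge type `A` (a submodule of scalar functions, left-invariant and continuous members) equipped with (detection) «a
  discrete `P` meeting the class of a member of `A` has `typeA`», (uniqueness) «at most one `typeA` `P` has finite component `σ`», (isotypic line)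
  «for every `P` the equivariant `A`-valued `ψ` contained in `P` lie on one line»: the intertwiners `σ → rightRep₂` valued in `A` lie on ONE line
  (namely `ℂψ₁` for any non-zero member; via the scalar junction J1″₂ ★ `ScalarSpectralJunction.hasFinComponent_of_not_orthogonal`).

References: [BorelJacquet1979] §4.6; [Dixmier1977] §5.4, §13.1; [Liu2021] Prop. D.4 (1) proof p. 130–131; [Rogawski1990] §11.
-/

set_option autoImplicit false
-- the mandated namespace repeats `HodgeConjecture.HodgeConjecture`, as in every `Theorems/*.lean` of this sub-problem
set_option linter.dupNamespace false

noncomputable section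

namespace Summit.HodgeConjecture.HodgeConjecture.Cruxes.HLiu418.IntertwiningLineOfLetters

open scoped InnerProductSpace ENNReal
open MeasureTheory NumberField
open Literature.NumberTheory.Automorphic Literature.NumberTheory.Automorphic.UnitaryGroup Literature.NumberTheory.Automorphic.UnitaryCurveForms
open Literature.NumberTheory.Automorphic.UnitaryGroup.CotangentForms (toQuotFun toQuotFun_mk)
open Summit.HodgeConjecture.HodgeConjecture.Cruxes.H413.F0P3HilbertProjection
open Summit.HodgeConjecture.HodgeConjecture.Cruxes.H413.SpectrumJunction
open Summit.HodgeConjecture.HodgeConjecture.Cruxes.HLiu418.ScalarSpectralJunction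
open Summit.HodgeConjecture.HodgeConjecture.Cruxes.H413.F0P3StubS3Fold (mem_space_of_forall_detected_eq)

/-! ## §1 «All projections but THE `P₀` vanish ⇒ the class lies in `P₀`» is ★ `F0P3StubS3Fold.mem_space_of_forall_detected_eq` (F0P3-p03), imported BY NAME -/

/-! ## §2 The generic core: one line of `A`-valued intertwiners from (TP⁺-detection, uniqueness, isotypic line) for a Hodge type `A` -/

section Core

variable {F₀ E : Type} [Field F₀] [NumberField F₀] [Field E] [NumberField E] [Algebra F₀ E]
  {c : E ≃ₐ[F₀] E} {J : Matrix (Fin 2) (Fin 2) E}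
  {μ : Measure (adelicGroupData F₀ E c 2 J).automorphicQuotient} [(adelicGroupData F₀ E c 2 J).IsAutomorphicMeasure μ]
  [CompactSpace (adelicGroupData F₀ E c 2 J).automorphicQuotient]

/-- **GENERIC CORE — one line of `A`-valued intertwiners.**  `U(J)(L)\U(J)(𝔸)` compact, `L²(μ)` discretely decomposable with multiplicity one; `σ`
IRREDUCIBLE on `W`; `A` a submodule of scalar functions whose members are left-`U(J)(L)`-invariant and continuous; `typeA P` a property of discrete `P`
such that (detection) a discrete `P` not orthogonal to the class of a member of `A` has `typeA`, (uniqueness) at most one `typeA` discrete `P` has finite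
component `σ`, and (isotypic line) for every discrete `P` the `rightRep₂`-equivariant linear `ψ : W → (U(J)(𝔸) → ℂ)` valued in `A` and contained in `P`
lie on one line.  THEN the intertwiners `σ → rightRep₂` valued in `A` lie on one line. [cite: BorelJacquet1979, §4.6] [cite: Dixmier1977, §5.4] -/
theorem exists_intertwiningLine_of_letters (hdisc : ((adelicGroupData F₀ E c 2 J).rightRegular μ).IsDiscretelyDecomposable)
    (h1 : ((adelicGroupData F₀ E c 2 J).rightRegular μ).HasMultiplicityOne)
    {W : Type} [AddCommGroup W] [Module ℂ W] (σ : Representation ℂ (finAdelic F₀ E c 2 J) W) (hσ : σ.IsIrreducible)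
    (A : Submodule ℂ ((adelicGroupData F₀ E c 2 J).Adelic → ℂ))
    (hleft : ∀ f ∈ A, ∀ γ ∈ (adelicGroupData F₀ E c 2 J).quotientSubgroup, ∀ x, f (γ * x) = f x)
    (hcontA : ∀ f ∈ A, Continuous f)
    (typeA : DiscreteAutomorphicRep (adelicGroupData F₀ E c 2 J) μ → Prop)
    (hdet : ∀ (P : DiscreteAutomorphicRep (adelicGroupData F₀ E c 2 J) μ) (f : (adelicGroupData F₀ E c 2 J).Adelic → ℂ), f ∈ A →
      ∀ hf : MemLp (toQuotFun (adelicGroupData F₀ E c 2 J) f) 2 μ,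
        (∃ u ∈ P.space, ⟪(u : (adelicGroupData F₀ E c 2 J).L2 μ), hf.toLp⟫_ℂ ≠ 0) → typeA P)
    (huniq : ∀ P P' : DiscreteAutomorphicRep (adelicGroupData F₀ E c 2 J) μ,
      typeA P → typeA P' → P.HasFinComponent σ → P'.HasFinComponent σ → P = P')
    (hline : ∀ P : DiscreteAutomorphicRep (adelicGroupData F₀ E c 2 J) μ,
      ∃ ψ₀ : W →ₗ[ℂ] ((adelicGroupData F₀ E c 2 J).Adelic → ℂ), ∀ ψ : W →ₗ[ℂ] ((adelicGroupData F₀ E c 2 J).Adelic → ℂ),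
        (∀ (g : finAdelic F₀ E c 2 J) (w : W), ψ (σ g w) = rightRep₂ F₀ E c J g (ψ w)) →
        (∀ w : W, ψ w ∈ A ∧ P.ContainsFun (ψ w)) → ∃ r : ℂ, ψ = r • ψ₀) :
    ∃ ψ₀ : σ.IntertwiningMap (rightRep₂ F₀ E c J), ∀ ψ : σ.IntertwiningMap (rightRep₂ F₀ E c J),
      (∀ w, ψ w ∈ A) → ∃ a : ℂ, ψ = a • ψ₀ := by
  haveI := hσ
  -- the degenerate case: no non-zero `A`-valued intertwiner
  by_cases hex : ∃ ψ₁ : σ.IntertwiningMap (rightRep₂ F₀ E c J), (∀ w, ψ₁ w ∈ A) ∧ ψ₁ ≠ 0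
  swap
  · refine ⟨0, fun ψ hψ => ⟨0, ?_⟩⟩
    have hψ0 : ψ = 0 := by
      by_contra hne
      exact hex ⟨ψ, hψ, hne⟩
    rw [hψ0, smul_zero]
  obtain ⟨ψ₁, hψ₁v, hψ₁0⟩ := hex
  -- bookkeeping for `A`-valued intertwiners: equivariance on values, `L²` classes, finite component and type of the discrete `P` they meet
  have heqv : ∀ (ψ : σ.IntertwiningMap (rightRep₂ F₀ E c J)) (g : finAdelic F₀ E c 2 J) (w : W) (x : (adelicGroupData F₀ E c 2 J).Adelic),
      ψ.toLinearMap (σ g w) x = ψ.toLinearMap w (x * finAdelicToAdelic F₀ E c 2 J g) := fun ψ g w x => by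
    show ψ (σ g w) x = ψ w _
    rw [Representation.IntertwiningMap.isIntertwining]
    rfl
  have heqvR : ∀ (ψ : σ.IntertwiningMap (rightRep₂ F₀ E c J)) (g : finAdelic F₀ E c 2 J) (w : W),
      ψ.toLinearMap (σ g w) = rightRep₂ F₀ E c J g (ψ.toLinearMap w) := fun ψ g w =>
    Representation.IntertwiningMap.isIntertwining _ _ ψ g w
  have hmem : ∀ (ψ : σ.IntertwiningMap (rightRep₂ F₀ E c J)), (∀ w, ψ w ∈ A) → ∀ w,
      MemLp (toQuotFun (adelicGroupData F₀ E c 2 J) (ψ w)) 2 μ := fun ψ hψ w =>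
    memLp_toQuotFun (hleft _ (hψ w)) (hcontA _ (hψ w))
  have hfin : ∀ (ψ : σ.IntertwiningMap (rightRep₂ F₀ E c J)) (hψ : ∀ w, ψ w ∈ A) (P : DiscreteAutomorphicRep (adelicGroupData F₀ E c 2 J) μ)
      (w : W), (∃ u ∈ P.space, ⟪(u : (adelicGroupData F₀ E c 2 J).L2 μ), (hmem ψ hψ w).toLp⟫_ℂ ≠ 0) → P.HasFinComponent σ :=
    fun ψ hψ P w hu => hasFinComponent_of_not_orthogonal P σ hσ ψ.toLinearMap (heqv ψ) (fun w => hleft _ (hψ w))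
      (fun w => hcontA _ (hψ w)) (hmem ψ hψ w) hu
  have htyp : ∀ (ψ : σ.IntertwiningMap (rightRep₂ F₀ E c J)) (hψ : ∀ w, ψ w ∈ A) (P : DiscreteAutomorphicRep (adelicGroupData F₀ E c 2 J) μ)
      (w : W), (∃ u ∈ P.space, ⟪(u : (adelicGroupData F₀ E c 2 J).L2 μ), (hmem ψ hψ w).toLp⟫_ℂ ≠ 0) → typeA P :=
    fun ψ hψ P w hu => hdet P (ψ w) (hψ w) (hmem ψ hψ w) hu
  -- THE `P₀`: an irreducible closed subspace meeting the class of a non-zero value of `ψ₁`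
  obtain ⟨w₁, hw₁⟩ : ∃ w, ψ₁ w ≠ 0 := by
    by_contra h
    push Not at h
    exact hψ₁0 (Representation.IntertwiningMap.ext (LinearMap.ext h))
  have hv₁ : (hmem ψ₁ hψ₁v w₁).toLp (toQuotFun (adelicGroupData F₀ E c 2 J) (ψ₁ w₁)) ≠ 0 :=
    toLp_toQuotFun_ne_zero (hleft _ (hψ₁v w₁)) (hcontA _ (hψ₁v w₁)) (hmem ψ₁ hψ₁v w₁) hw₁
  obtain ⟨W₀, hW₀irr, u₁, hu₁, hu₁v⟩ := exists_irreducible_not_orthogonal hdisc hv₁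
  let P₀ : DiscreteAutomorphicRep (adelicGroupData F₀ E c 2 J) μ := ⟨W₀, hW₀irr⟩
  have hP₀t : typeA P₀ := htyp ψ₁ hψ₁v P₀ w₁ ⟨u₁, hu₁, hu₁v⟩
  have hP₀f : P₀.HasFinComponent σ := hfin ψ₁ hψ₁v P₀ w₁ ⟨u₁, hu₁, hu₁v⟩
  -- every `A`-valued intertwiner is CONTAINED in `P₀`
  have hcont' : ∀ (ψ : σ.IntertwiningMap (rightRep₂ F₀ E c J)) (hψ : ∀ w, ψ w ∈ A) (w : W), P₀.ContainsFun (ψ w) :=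
    fun ψ hψ w => ⟨hmem ψ hψ w, mem_space_of_forall_detected_eq hdisc h1 P₀ _ fun P hu =>
      huniq P P₀ (htyp ψ hψ P w hu) hP₀t (hfin ψ hψ P w hu) hP₀f⟩
  -- the isotypic line at `P₀`: `ψ = r • φ₀`, `ψ₁ = r₁ • φ₀` with `r₁ ≠ 0`
  obtain ⟨φ₀, hφ₀⟩ := hline P₀
  obtain ⟨r₁, hr₁⟩ := hφ₀ ψ₁.toLinearMap (heqvR ψ₁) fun w => ⟨hψ₁v w, hcont' ψ₁ hψ₁v w⟩
  have hr₁0 : r₁ ≠ 0 := by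
    rintro rfl
    apply hψ₁0
    apply Representation.IntertwiningMap.ext
    rw [hr₁, zero_smul]
    rfl
  refine ⟨ψ₁, fun ψ hψ => ?_⟩
  obtain ⟨r, hr⟩ := hφ₀ ψ.toLinearMap (heqvR ψ) fun w => ⟨hψ w, hcont' ψ hψ w⟩
  refine ⟨r * r₁⁻¹, Representation.IntertwiningMap.ext ?_⟩
  rw [Representation.IntertwiningMap.toLinearMap_smul, hr₁, smul_smul, mul_assoc, inv_mul_cancel₀ hr₁0, mul_one, hr]

end Core

end Summit.HodgeConjecture.HodgeConjecture.Cruxes.HLiu418.IntertwiningLineOfLetters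

end
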